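import Mathlib
import Summits.ValiantsHypothesis.ValiantsHypothesis.Theorems.NewtonUnitEquationsTwoProductsDepthOne
/-! # Stub `stub_peelShallow` — crux `TwoProducts` (stmt-ValiantsHypothesis-5906), line `corner-log-linearization`
   The PEEL–SHALLOW REDUCTION.

   Setting: bivariate polynomials `u_i` (`i < k`), `v_j` (`j < m`) with every `v_j` of constant term `1`,
   and a further polynomial `p`.  In the power series ring put `U = ∏ ↑u_i`, `Q = ∏ ↑v_j` (constant
   term `1`, hence `Q * Q⁻¹ = 1`) and `G = U * Q⁻¹`.  The polynomial `D = ∏ u_i - p * ∏ v_j` satisfies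
   `↑D = U - ↑p * Q = Q * (G - ↑p)`.  Key lemma (`strictMin_of_mul`): multiplying a power series `ρ` by
   a power series `Q` with constant term `1` does not move a strict minimiser of a positive-weight
   linear form over the support — if `e` is a strict `w`-minimiser of `supp (Q * ρ)` then it is a strict
   `w`-minimiser of `supp ρ` (induction on the weight: the Cauchy product at an exponent `q` that is
   `w`-lighter than or equal to `e` has only the term `Q_0 ρ_q = ρ_q`, all other terms involving
   strictly lighter exponents of `ρ`).  Applied to `ρ = G - ↑p`: at every exponent `q ≠ e` that is
   `w`-lighter than or equal to `e` the series `G` agrees with `p`, and at `e` itself either `p_e ≠ 0`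
   or `G_e ≠ 0`.  In the crux this feeds the bound "number of south-west vertices `≤ t +` number of
   `t`-shallow support points of `G`". [folklore] -/
set_option linter.dupNamespace false -- single-conjunct summit: `ValiantsHypothesis.ValiantsHypothesis`
namespace Summit.ValiantsHypothesis.ValiantsHypothesis.Theorems.TwoProducts.PeelShallow
open scoped BigOperators
open Summit.ValiantsHypothesis.ValiantsHypothesis.Theorems.TwoProducts.DepthOne

/-- The weight `w₀x₀ + w₁x₁` is additive. [folklore] -/
theorem wt_add (w : Fin 2 → ℤ) (a b : Fin 2 →₀ ℕ) :
    w 0 * ((a + b) 0 : ℤ) + w 1 * ((a + b) 1 : ℤ) =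
      (w 0 * (a 0 : ℤ) + w 1 * (a 1 : ℤ)) + (w 0 * (b 0 : ℤ) + w 1 * (b 1 : ℤ)) := by
  simp only [Finsupp.add_apply]
  push_cast
  ring

/-- CAUCHY PRODUCT WITH A UNIT SERIES, ONE SURVIVING TERM.  If `Q` has constant term `1` and every
`ρ_b` with `a + b = q`, `a ≠ 0` vanishes, then `(Q * ρ)_q = ρ_q`. [folklore] -/
theorem coeff_mul_eq_of_vanish {Q ρ : MvPowerSeries (Fin 2) ℂ}
    (hQ : MvPowerSeries.constantCoeff Q = 1) (q : Fin 2 →₀ ℕ)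
    (hq : ∀ a b : Fin 2 →₀ ℕ, a + b = q → a ≠ 0 → MvPowerSeries.coeff b ρ = 0) :
    MvPowerSeries.coeff q (Q * ρ) = MvPowerSeries.coeff q ρ := by
  classical
  rw [MvPowerSeries.coeff_mul, Finset.sum_eq_single (0, q)]
  · rw [MvPowerSeries.coeff_zero_eq_constantCoeff_apply, hQ, one_mul]
  · rintro ⟨a, b⟩ hab hne
    have hab' : a + b = q := by simpa using hab
    have ha : a ≠ 0 := by
      rintro rfl
      exact hne (by rw [← hab', zero_add])
    dsimp only
    rw [hq a b hab' ha, mul_zero]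
  · intro h
    exact absurd (Finset.HasAntidiagonal.mem_antidiagonal.mpr (zero_add q)) h

/-- KEY LEMMA (a unit series does not move the lowest point).  Let `Q` be a bivariate power series
with constant term `1`, `w` a weight with both entries positive, and `e` a strict `w`-minimiser of the
support of `Q * ρ` (i.e. `(Q * ρ)_e ≠ 0` and `(Q * ρ)_q = 0` for every `q ≠ e` of weight `≤` that of
`e`).  Then `e` is a strict `w`-minimiser of the support of `ρ`. [folklore] -/
theorem strictMin_of_mul {Q ρ : MvPowerSeries (Fin 2) ℂ} (hQ : MvPowerSeries.constantCoeff Q = 1)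
    (w : Fin 2 → ℤ) (hw0 : 0 < w 0) (hw1 : 0 < w 1) (e : Fin 2 →₀ ℕ)
    (hDe : MvPowerSeries.coeff e (Q * ρ) ≠ 0)
    (hmin : ∀ q : Fin 2 →₀ ℕ, q ≠ e →
      w 0 * (q 0 : ℤ) + w 1 * (q 1 : ℤ) ≤ w 0 * (e 0 : ℤ) + w 1 * (e 1 : ℤ) →
        MvPowerSeries.coeff q (Q * ρ) = 0) :
    MvPowerSeries.coeff e ρ ≠ 0 ∧ ∀ q : Fin 2 →₀ ℕ, q ≠ e →
      w 0 * (q 0 : ℤ) + w 1 * (q 1 : ℤ) ≤ w 0 * (e 0 : ℤ) + w 1 * (e 1 : ℤ) →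
        MvPowerSeries.coeff q ρ = 0 := by
  -- the second conjunct, by induction on a natural bound for the weight of `q`
  have h2 : ∀ n : ℕ, ∀ q : Fin 2 →₀ ℕ, w 0 * (q 0 : ℤ) + w 1 * (q 1 : ℤ) < n → q ≠ e →
      w 0 * (q 0 : ℤ) + w 1 * (q 1 : ℤ) ≤ w 0 * (e 0 : ℤ) + w 1 * (e 1 : ℤ) →
        MvPowerSeries.coeff q ρ = 0 := by
    intro n
    induction n with
    | zero =>
      intro q hn _ _
      exact absurd (wt_nonneg w hw0 hw1 q) (not_le.mpr (by exact_mod_cast hn))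
    | succ n ih =>
      intro q hn hqe hle
      rw [← coeff_mul_eq_of_vanish hQ q fun a b hab ha => ?_]
      · exact hmin q hqe hle
      · have hwa := wt_pos w hw0 hw1 a ha
        have hsum := wt_add w a b
        rw [hab] at hsum
        have hbe : b ≠ e := by
          rintro rfl
          linarith
        refine ih b ?_ hbe (by linarith)
        push_cast at hn
        linarith
  have h2' : ∀ q : Fin 2 →₀ ℕ, q ≠ e →
      w 0 * (q 0 : ℤ) + w 1 * (q 1 : ℤ) ≤ w 0 * (e 0 : ℤ) + w 1 * (e 1 : ℤ) →
        MvPowerSeries.coeff q ρ = 0 := by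
    intro q hqe hle
    obtain ⟨n, hn⟩ := Int.eq_ofNat_of_zero_le (wt_nonneg w hw0 hw1 q)
    refine h2 (n + 1) q ?_ hqe hle
    rw [hn]
    push_cast
    linarith
  refine ⟨?_, h2'⟩
  rw [← coeff_mul_eq_of_vanish hQ e fun a b hab ha => ?_]
  · exact hDe
  · have hwa := wt_pos w hw0 hw1 a ha
    have hsum := wt_add w a b
    rw [hab] at hsum
    have hbe : b ≠ e := by
      rintro rfl
      linarith
    exact h2' b hbe (by linarith)

/-- **Peel–shallow reduction** (rung `stub_peelShallow`, registered signature).  With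
`G = (∏ ↑u_i) * (∏ ↑v_j)⁻¹` (all `v_j` of constant term `1`) and `e` a strict `w`-minimiser (`w > 0`)
of the support of `∏ u_i - p * ∏ v_j`: either `e ∈ supp p`, or `G_e ≠ 0` and every support point
`q ≠ e` of `G` of `w`-weight at most that of `e` lies in `supp p`. [folklore] -/
theorem stub_peelShallow : ∀ (k m : ℕ) (u : Fin k → MvPolynomial (Fin 2) ℂ) (v : Fin m → MvPolynomial (Fin 2) ℂ) (p : MvPolynomial (Fin 2) ℂ), (∀ j, MvPolynomial.coeff 0 (v j) = 1) → ∀ (w : Fin 2 → ℤ), 0 < w 0 → 0 < w 1 → ∀ (e : Fin 2 →₀ ℕ), (e ∈ ((∏ i, u i) - p * ∏ j, v j).support ∧ ∀ e' ∈ ((∏ i, u i) - p * ∏ j, v j).support, e' ≠ e → w 0 * (e 0 : ℤ) + w 1 * (e 1 : ℤ) < w 0 * (e' 0 : ℤ) + w 1 * (e' 1 : ℤ)) → e ∈ p.support ∨ (MvPowerSeries.coeff e ((∏ i, ((u i : MvPolynomial (Fin 2) ℂ) : MvPowerSeries (Fin 2) ℂ)) * (∏ j, ((v j : MvPolynomial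 (Fin 2) ℂ) : MvPowerSeries (Fin 2) ℂ))⁻¹) ≠ 0 ∧ ∀ q : Fin 2 →₀ ℕ, q ≠ 0 → q ≠ e → MvPowerSeries.coeff q ((∏ i, ((u i : MvPolynomial (Fin 2) ℂ) : MvPowerSeries (Fin 2) ℂ)) * (∏ j, ((v j : MvPolynomial (Fin 2) ℂ) : MvPowerSeries (Fin 2) ℂ))⁻¹) ≠ 0 → w 0 * (q 0 : ℤ) + w 1 * (q 1 : ℤ) ≤ w 0 * (e 0 : ℤ) + w 1 * (e 1 : ℤ) → q ∈ p.support) := by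
  intro k m u v p hv w hw0 hw1 e he
  obtain ⟨heD, hmin'⟩ := he
  set D : MvPolynomial (Fin 2) ℂ := (∏ i, u i) - p * ∏ j, v j with hD
  set U : MvPowerSeries (Fin 2) ℂ :=
    ∏ i, ((u i : MvPolynomial (Fin 2) ℂ) : MvPowerSeries (Fin 2) ℂ) with hU
  set Q : MvPowerSeries (Fin 2) ℂ :=
    ∏ j, ((v j : MvPolynomial (Fin 2) ℂ) : MvPowerSeries (Fin 2) ℂ) with hQdef
  -- `Q` has constant term `1`, hence is cancelled by its inverse
  have hQ1 : MvPowerSeries.constantCoeff Q = 1 := by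
    rw [hQdef, map_prod]
    refine Finset.prod_eq_one fun j _ => ?_
    rw [← MvPowerSeries.coeff_zero_eq_constantCoeff_apply, MvPolynomial.coeff_coe]
    exact hv j
  have hQinv : Q * Q⁻¹ = 1 := MvPowerSeries.mul_inv_cancel Q (by rw [hQ1]; exact one_ne_zero)
  -- the factorisation `↑D = Q * (G - ↑p)`
  have hcoe : ((D : MvPolynomial (Fin 2) ℂ) : MvPowerSeries (Fin 2) ℂ) =
      U - ((p : MvPolynomial (Fin 2) ℂ) : MvPowerSeries (Fin 2) ℂ) * Q := by
    rw [hD, hU, hQdef, ← MvPolynomial.coeToMvPowerSeries.ringHom_apply, map_sub, map_mul, map_prod,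
      map_prod]
    rfl
  have hfac : ((D : MvPolynomial (Fin 2) ℂ) : MvPowerSeries (Fin 2) ℂ) =
      Q * (U * Q⁻¹ - ((p : MvPolynomial (Fin 2) ℂ) : MvPowerSeries (Fin 2) ℂ)) := by
    rw [hcoe]
    calc U - ((p : MvPolynomial (Fin 2) ℂ) : MvPowerSeries (Fin 2) ℂ) * Q
        = U * (Q * Q⁻¹) - ((p : MvPolynomial (Fin 2) ℂ) : MvPowerSeries (Fin 2) ℂ) * Q := by
          rw [hQinv, mul_one]
      _ = Q * (U * Q⁻¹ - ((p : MvPolynomial (Fin 2) ℂ) : MvPowerSeries (Fin 2) ℂ)) := by ring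
  -- `e` is a strict `w`-minimiser of the support of `↑D = Q * (G - ↑p)`
  have hDe : MvPowerSeries.coeff e
      (Q * (U * Q⁻¹ - ((p : MvPolynomial (Fin 2) ℂ) : MvPowerSeries (Fin 2) ℂ))) ≠ 0 := by
    rw [← hfac, MvPolynomial.coeff_coe]
    exact MvPolynomial.mem_support_iff.mp heD
  have hminD : ∀ q : Fin 2 →₀ ℕ, q ≠ e →
      w 0 * (q 0 : ℤ) + w 1 * (q 1 : ℤ) ≤ w 0 * (e 0 : ℤ) + w 1 * (e 1 : ℤ) →
        MvPowerSeries.coeff q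
          (Q * (U * Q⁻¹ - ((p : MvPolynomial (Fin 2) ℂ) : MvPowerSeries (Fin 2) ℂ))) = 0 := by
    intro q hqe hle
    rw [← hfac, MvPolynomial.coeff_coe]
    by_contra hne
    exact absurd hle (not_le.mpr (hmin' q (MvPolynomial.mem_support_iff.mpr hne) hqe))
  -- hence of the support of `G - ↑p`
  obtain ⟨hρe, hρ⟩ := strictMin_of_mul hQ1 w hw0 hw1 e hDe hminD
  by_cases hep : e ∈ p.support
  · exact Or.inl hep
  right
  have hpe : MvPolynomial.coeff e p = 0 := by
    simpa [MvPolynomial.mem_support_iff] using hep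
  refine ⟨?_, ?_⟩
  · intro hG
    apply hρe
    rw [map_sub, hG, MvPolynomial.coeff_coe, hpe, sub_zero]
  · intro q _ hqe hGq hle
    have h := hρ q hqe hle
    rw [map_sub, sub_eq_zero, MvPolynomial.coeff_coe] at h
    rw [MvPolynomial.mem_support_iff, ← h]
    exact hGq

end Summit.ValiantsHypothesis.ValiantsHypothesis.Theorems.TwoProducts.PeelShallow
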